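import Summits.Ventures.YMGap.FlowData.SymmetryBlockMerge

/-!
# Venture YMGap, track Y3 FLOW-DATA — the COUNTING ROUTE for the top of an uncomputed complement block

HONEST FRAMING: venture file of the cell `pub-ymgap` (QuantumFields programme), track Y3, lineage B
(flow-eng-2, engine «kstm»).  Finite linear algebra only; no lattice object, no number, no row, nothing about
limits, a continuum or a mass gap.

Lineage B certifies, for the zero-momentum zero-flux sector of the compressed transfer matrix, the sorted
spectrum of the WHOLE sector block `T` (all point-group irreps together; index-wise enclosures) and of the
exactly projected `A₁` sub-block `T_A` (isometry `B_A`, `T B_A = B_A T_A`).  The rows `lambda0_nonA1_p0`,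
`m_nonA1` and the level-ordering observable `s = m_nonA1 − m` need the TOP EIGENVALUE `ν₀` of the COMPLEMENT
block `T_C` (the non-`A₁` part), which the engine never assembles on rectangles (`rows.py`, function
`top_complement`, «certified by COUNTING»).  The counting argument: `spec T = spec T_A ⊔ spec T_C` as
multisets; if `k` is an index with `λ↓_k(T) > λ↓_k(T_A)` and (for `k ≥ 1`) `λ↓_{k-1}(T_A) > λ↓_k(T)`, then
exactly `k` eigenvalues of `T` and of `T_A` lie above `λ↓_k(T)`, none of `T_C` does, and `λ↓_k(T)` itself is
not an eigenvalue of `T_A` — so it is the complement's top: **`ν₀ = λ↓_k(T)`** (`complement_top_eq`), whence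
the enclosure of `ν₀` is the enclosure of `λ↓_k(T)` (`complement_top_mem_Icc`, the row's interval).

Both inequalities are instances of flow-eng-1's typed merge theorems for symmetry blocks
(`FlowData/SymmetryBlockMerge.lean`: `BlockMerge.eigenvalues₀_le_of_blocks` = upper merge under completeness,
`BlockMerge.le_eigenvalues₀_of_blocks` = lower merge from pushed-forward block eigenvectors), specialised to
TWO blocks indexed by `Bool` (`true` = the computed sub-block `A`, `false` = its complement `C`): no new
analysis, only the bookkeeping that turns two certified sorted lists into the complement's top.  The strict
hypotheses are exactly what `top_complement` checks on the certified enclosures (first separating index `k`,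
common gap above it).

References: R. A. Horn, C. R. Johnson, *Matrix Analysis* (2nd ed. 2013), Thm 4.2.6 (Courant–Fischer),
Thm 1.3.22 [cite: HornJohnson2013, Thm 4.2.6]; the cell's HOME/pub-ymgap-flow-eng-2/rows.py `top_complement`
(2026-08-22) and flow-ref FR-18/FR-110.
-/

noncomputable section

open Matrix Finset
open scoped BigOperators

namespace Summit.Ventures.YMGap.FlowData

namespace ComplementTop

variable {𝕜 : Type*} [RCLike 𝕜] {m : Type*} [Fintype m] [DecidableEq m]
  {n : Bool → Type*} [∀ b, Fintype (n b)] [∀ b, DecidableEq (n b)]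

/-- **LOWER HALF of the counting route** (needs completeness).  Two blocks `B true = B_A`, `B false = B_C`
with invariance `T B_b = B_b T_b` and completeness `B_A B_Aᴴ + B_C B_Cᴴ = 1`: if level `k` of the whole
sector lies STRICTLY above level `k` of the sub-block `A`, then it lies below the complement's top,
`λ↓_k(T) ≤ λ↓_0(T_C)` — by the upper merge with budgets `k_A = k`, `k_C = 0` and the bound
`c = max(λ↓_k(T_A), λ↓_0(T_C))`. [cite: HornJohnson2013, Thm 4.2.6] -/
theorem eigenvalues₀_le_complement_top {T : Matrix m m 𝕜} (hT : T.IsHermitian)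
    (B : ∀ b, Matrix m (n b) 𝕜) {Tb : ∀ b, Matrix (n b) (n b) 𝕜} (hTb : ∀ b, (Tb b).IsHermitian)
    (hinv : ∀ b, T * B b = B b * Tb b) (hcomp : ∑ b, B b * (B b)ᴴ = 1)
    (k : ℕ) (hkA : k < Fintype.card (n true)) (hkm : k < Fintype.card m) (hC : 0 < Fintype.card (n false))
    (hsep : (hTb true).eigenvalues₀ ⟨k, hkA⟩ < hT.eigenvalues₀ ⟨k, hkm⟩) :
    hT.eigenvalues₀ ⟨k, hkm⟩ ≤ (hTb false).eigenvalues₀ ⟨0, hC⟩ := by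
  set c : ℝ := max ((hTb true).eigenvalues₀ ⟨k, hkA⟩) ((hTb false).eigenvalues₀ ⟨0, hC⟩) with hc_def
  have hle : hT.eigenvalues₀ ⟨k, hkm⟩ ≤ c := by
    refine BlockMerge.eigenvalues₀_le_of_blocks hT B hTb hinv hcomp (fun b => if b then k else 0) ?_
      ⟨k, hkm⟩ ?_
    · intro b h
      cases b with
      | true => exact le_max_left _ _
      | false => exact le_max_right _ _
    · simp
  rcases le_max_iff.mp hle with h | h
  · exact absurd h (not_le.mpr hsep)
  · exact h

/-- **UPPER HALF of the counting route** (needs block orthonormality, not completeness).  With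
`B_bᴴ B_b = 1`, `B_Aᴴ B_C = 0` and invariance: if (for `k ≥ 1`) level `k-1` of the sub-block `A` lies
STRICTLY above level `k` of the whole sector, then the complement's top lies at or below that level,
`λ↓_0(T_C) ≤ λ↓_k(T)` — otherwise the `k` head eigenvectors of `A` and the top eigenvector of `C`, pushed
forward, would be `k + 1` orthonormal eigenvectors of `T` with eigenvalues `> λ↓_k(T)` (lower merge with
budgets `k_A = k`, `k_C = 1`). [cite: HornJohnson2013, Thm 4.2.6] -/
theorem complement_top_le_eigenvalues₀ {T : Matrix m m 𝕜} (hT : T.IsHermitian)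
    (B : ∀ b, Matrix m (n b) 𝕜) {Tb : ∀ b, Matrix (n b) (n b) 𝕜} (hTb : ∀ b, (Tb b).IsHermitian)
    (hinv : ∀ b, T * B b = B b * Tb b) (hiso : ∀ b, (B b)ᴴ * B b = 1)
    (horth : ∀ b b', b ≠ b' → (B b)ᴴ * B b' = 0)
    (k : ℕ) (hkA : k < Fintype.card (n true)) (hkm : k < Fintype.card m) (hC : 0 < Fintype.card (n false))
    (hgap : ∀ hk : 0 < k, hT.eigenvalues₀ ⟨k, hkm⟩ < (hTb true).eigenvalues₀ ⟨k - 1, by omega⟩) :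
    (hTb false).eigenvalues₀ ⟨0, hC⟩ ≤ hT.eigenvalues₀ ⟨k, hkm⟩ := by
  by_contra hlt
  push Not at hlt
  -- σ := min over the pushed-forward heads: the top of `C` and (if `k ≥ 1`) level `k-1` of `A`
  set σ : ℝ := if hk : 0 < k then min ((hTb false).eigenvalues₀ ⟨0, hC⟩)
      ((hTb true).eigenvalues₀ ⟨k - 1, by omega⟩) else (hTb false).eigenvalues₀ ⟨0, hC⟩ with hσ_def
  have hσlt : hT.eigenvalues₀ ⟨k, hkm⟩ < σ := by
    by_cases hk : 0 < k
    · rw [hσ_def, dif_pos hk]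
      exact lt_min hlt (hgap hk)
    · rw [hσ_def, dif_neg hk]
      exact hlt
  have hσle : σ ≤ hT.eigenvalues₀ ⟨k, hkm⟩ := by
    refine BlockMerge.le_eigenvalues₀_of_blocks hT B hTb hinv hiso horth (fun b => if b then k else 1)
      ?_ ?_ ⟨k, hkm⟩ ?_
    · intro b
      cases b with
      | true => exact hkA.le
      | false => exact hC
    · intro b l hl
      cases b with
      | false =>
        have hl0 : l = ⟨0, hC⟩ := Fin.ext (by simpa using hl)
        subst hl0
        by_cases hk : 0 < k
        · rw [hσ_def, dif_pos hk]; exact min_le_left _ _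
        · rw [hσ_def, dif_neg hk]
      | true =>
        have hlk : (l : ℕ) < k := by simpa using hl
        have hk : 0 < k := by omega
        have hl' : (l : ℕ) ≤ k - 1 := by omega
        rw [hσ_def, dif_pos hk]
        refine (min_le_right _ _).trans ?_
        exact (hTb true).eigenvalues₀_antitone (Fin.le_iff_val_le_val.mpr hl')
    · simp
  exact absurd (lt_of_lt_of_le hσlt hσle) (lt_irrefl _)

/-- ★ **THE COUNTING ROUTE** (`rows.py top_complement`).  Two blocks — the computed sub-block `A`
(`B true`) and its uncomputed complement `C` (`B false`) — with invariance `T B_b = B_b T_b`, orthonormal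
and mutually orthogonal columns and completeness `Σ_b B_b B_bᴴ = 1` (so `spec T = spec T_A ⊔ spec T_C`).
If `k` indexes a level with `λ↓_k(T_A) < λ↓_k(T)` and, when `k ≥ 1`, `λ↓_k(T) < λ↓_{k-1}(T_A)` (the «first
separating index with a common gap above it»), then the complement's TOP eigenvalue IS that sector level:
`λ↓_0(T_C) = λ↓_k(T)`. [cite: HornJohnson2013, Thm 4.2.6] -/
theorem complement_top_eq {T : Matrix m m 𝕜} (hT : T.IsHermitian)
    (B : ∀ b, Matrix m (n b) 𝕜) {Tb : ∀ b, Matrix (n b) (n b) 𝕜} (hTb : ∀ b, (Tb b).IsHermitian)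
    (hinv : ∀ b, T * B b = B b * Tb b) (hiso : ∀ b, (B b)ᴴ * B b = 1)
    (horth : ∀ b b', b ≠ b' → (B b)ᴴ * B b' = 0) (hcomp : ∑ b, B b * (B b)ᴴ = 1)
    (k : ℕ) (hkA : k < Fintype.card (n true)) (hkm : k < Fintype.card m) (hC : 0 < Fintype.card (n false))
    (hsep : (hTb true).eigenvalues₀ ⟨k, hkA⟩ < hT.eigenvalues₀ ⟨k, hkm⟩)
    (hgap : ∀ hk : 0 < k, hT.eigenvalues₀ ⟨k, hkm⟩ < (hTb true).eigenvalues₀ ⟨k - 1, by omega⟩) :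
    (hTb false).eigenvalues₀ ⟨0, hC⟩ = hT.eigenvalues₀ ⟨k, hkm⟩ :=
  le_antisymm (complement_top_le_eigenvalues₀ hT B hTb hinv hiso horth k hkA hkm hC hgap)
    (eigenvalues₀_le_complement_top hT B hTb hinv hcomp k hkA hkm hC hsep)

/-- **The row's interval.**  In the situation of `complement_top_eq`, stated with CERTIFIED ENCLOSURES as the
engine has them: index-wise radii `dP` for the sector's computed levels `P i` (`|λ↓_i(T) − P i| ≤ dP`) and
`dA` for the sub-block's levels `A i` (`|λ↓_i(T_A) − A i| ≤ dA`), the separation test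
`A k + dA < P k − dP` and (for `k ≥ 1`) the gap test `P k + dP < A (k-1) − dA` — exactly the two comparisons
of `top_complement` — give `λ↓_0(T_C) ∈ [P k − dP, P k + dP]`.  (The additional tail term `+ κΩ` of the
published row is the K-weight tail theorem applied afterwards to the complement block of the FULL matrix.)
[cite: HornJohnson2013, Thm 4.2.6] -/
theorem complement_top_mem_Icc {T : Matrix m m 𝕜} (hT : T.IsHermitian)
    (B : ∀ b, Matrix m (n b) 𝕜) {Tb : ∀ b, Matrix (n b) (n b) 𝕜} (hTb : ∀ b, (Tb b).IsHermitian)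
    (hinv : ∀ b, T * B b = B b * Tb b) (hiso : ∀ b, (B b)ᴴ * B b = 1)
    (horth : ∀ b b', b ≠ b' → (B b)ᴴ * B b' = 0) (hcomp : ∑ b, B b * (B b)ᴴ = 1)
    (k : ℕ) (hkA : k < Fintype.card (n true)) (hkm : k < Fintype.card m) (hC : 0 < Fintype.card (n false))
    {P A : ℕ → ℝ} {dP dA : ℝ}
    (hP : ∀ i (h : i < Fintype.card m), i ≤ k → |hT.eigenvalues₀ ⟨i, h⟩ - P i| ≤ dP)
    (hA : ∀ i (h : i < Fintype.card (n true)), i ≤ k → |(hTb true).eigenvalues₀ ⟨i, h⟩ - A i| ≤ dA)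
    (hsep : A k + dA < P k - dP) (hgap : 0 < k → P k + dP < A (k - 1) - dA) :
    (hTb false).eigenvalues₀ ⟨0, hC⟩ ∈ Set.Icc (P k - dP) (P k + dP) := by
  have hPk := abs_le.mp (hP k hkm le_rfl)
  have hAk := abs_le.mp (hA k hkA le_rfl)
  have hsep' : (hTb true).eigenvalues₀ ⟨k, hkA⟩ < hT.eigenvalues₀ ⟨k, hkm⟩ := by linarith [hPk.1, hAk.2]
  have hgap' : ∀ hk : 0 < k, hT.eigenvalues₀ ⟨k, hkm⟩ < (hTb true).eigenvalues₀ ⟨k - 1, by omega⟩ := by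
    intro hk
    have hAk1 := abs_le.mp (hA (k - 1) (by omega) (by omega))
    linarith [hPk.2, hAk1.1, hgap hk]
  rw [complement_top_eq hT B hTb hinv hiso horth hcomp k hkA hkm hC hsep' hgap']
  exact ⟨by linarith [hPk.1], by linarith [hPk.2]⟩

end ComplementTop

end Summit.Ventures.YMGap.FlowData
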